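import Summits.QuantumAdvantage.QuantumAdvantage.Theorems.ScaleDialB

/-!
# ScaleDial, part C/3: ABSORPTION `noPerfectOdd3_iff_qml3 : NoPerfectOdd3 ↔ QML3` (exchange rate `absorb`: `< 2^k` odd
losses on `C_(m+1+3k)` at degree `d` ⟹ `PerfectAt (m+1) ((3k+1)²(2d+1))`), the node equation
`massStep3u_iff_pieces : MassStep3u ↔ (MesoLift3 ∧ TopLift3)` and `closes` BY NAME — support for item 26533

Cell decomp-qadv, seat lens-1 («grading / quantitative ladder»), generation 12 — land port of the node «ScaleDial»
(published under the cell's HOME/decomp-qadv-lens-1/g12/ScaleDial.lean, record NODE-g12.md; RESIDUAL MODE on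
ExactnessDial:26533 `MassStep3u := NoPerfectOdd3 → PolyLossOddU3`).  Prop-defs = the node's rungs / pieces / predicates
only.  No `sorry`, no new axioms, no instances, no notation.  (Predicates declared here: `IsInd`, `Wins`, `PerfectAt`, `ProfLE`; data defs `iota`, `bx`, `cInd`,
`bits`, `Str`, `lDeg`, `eDeg`, `uTok`, `vTok`.)
-/

set_option linter.dupNamespace false
set_option linter.style.longLine false

noncomputable section

open scoped Classical

namespace Summit.QuantumAdvantage.QuantumAdvantage.Theorems.ScaleDial

open Finset
open Literature.Computability.QuantumComplexity Literature.Computability.QuantumComplexity.RingHLF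
open Literature.Computability.MetaComplexity Literature.Computability.MetaComplexity.Smolensky
open Summit.QuantumAdvantage.AdviceFreeQNC0
open Summit.QuantumAdvantage.QuantumAdvantage.Theorems.RingPeriodFold (cov covStrat covStrat_mem_lowDeg)
open Summit.QuantumAdvantage.QuantumAdvantage.Theses.ExactnessDial (NoPerfectOdd3 PolyLossOddU3 MassStep3u OddToAll3
  DPLift3 MultiRingBridge3 NoPerfectConst3)

section Absorb

/-! ### C3. Indicator (`{0,1}`-valued) polynomial toolkit over `𝔽₃` — degrees ADD under XOR, no repeated squaring -/

/-- `{0,1}`-valued cube function. -/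
def IsInd {n : ℕ} (f : CubeFn (ZMod 3) n) : Prop := ∀ x, f x = 0 ∨ f x = 1

/-- indicator normal form `ι f = 1 − (f−1)²`: `{0,1}`-valued, same reply bit `[ι f = 1] = [f = 1]`, degree doubles ONCE. -/
def iota {n : ℕ} (f : CubeFn (ZMod 3) n) : CubeFn (ZMod 3) n := 1 - (f - 1) * (f - 1)

/-- ScaleDialCA helper `iota_isInd` (decomp-qadv land package; see the module docstring). -/
theorem iota_isInd {n : ℕ} (f : CubeFn (ZMod 3) n) : IsInd (iota f) := by
  intro x
  simp only [iota, Pi.sub_apply, Pi.mul_apply, Pi.one_apply]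
  have htab : ∀ a : ZMod 3, (1 - (a - 1) * (a - 1) = 0) ∨ (1 - (a - 1) * (a - 1) = 1) := by decide
  exact htab (f x)

/-- ScaleDialCA helper `iota_bit` (decomp-qadv land package; see the module docstring). -/
theorem iota_bit {n : ℕ} (f : CubeFn (ZMod 3) n) (x : Fin n → Bool) : decide (iota f x = 1) = decide (f x = 1) := by
  simp only [iota, Pi.sub_apply, Pi.mul_apply, Pi.one_apply]
  have htab : ∀ a : ZMod 3, decide (1 - (a - 1) * (a - 1) = 1) = decide (a = 1) := by decide
  exact htab (f x)

/-- ScaleDialCA helper `iota_mem_lowDeg` (decomp-qadv land package; see the module docstring). -/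
theorem iota_mem_lowDeg {n d : ℕ} {f : CubeFn (ZMod 3) n} (hf : f ∈ lowDeg (ZMod 3) n d) :
    iota f ∈ lowDeg (ZMod 3) n (2 * d) := by
  have h1 := Summit.QuantumAdvantage.QuantumAdvantage.Theorems.WildDialDoll.one_mem_lowDeg n d
  have h1' := Summit.QuantumAdvantage.QuantumAdvantage.Theorems.WildDialDoll.one_mem_lowDeg n (2 * d)
  have hsq : (f - 1) * (f - 1) ∈ lowDeg (ZMod 3) n (2 * d) := by
    rw [two_mul]; exact mul_mem_lowDeg_add (Submodule.sub_mem _ hf h1) (Submodule.sub_mem _ hf h1)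
  exact Submodule.sub_mem _ h1' hsq

/-- Boolean XOR of indicators inside `𝔽₃`: `a ⊕ b = a + b + ab` (`1+1+1 = 0`). Degrees ADD. -/
def bx {n : ℕ} (f g : CubeFn (ZMod 3) n) : CubeFn (ZMod 3) n := f + g + f * g

/-- ScaleDialCA helper `bx_isInd` (decomp-qadv land package; see the module docstring). -/
theorem bx_isInd {n : ℕ} {f g : CubeFn (ZMod 3) n} (hf : IsInd f) (hg : IsInd g) : IsInd (bx f g) := by
  intro x
  simp only [bx, Pi.add_apply, Pi.mul_apply]
  have htab : ∀ a b : ZMod 3, (a = 0 ∨ a = 1) → (b = 0 ∨ b = 1) → (a + b + a * b = 0 ∨ a + b + a * b = 1) := by decide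
  exact htab _ _ (hf x) (hg x)

/-- ScaleDialCA helper `bx_bit` (decomp-qadv land package; see the module docstring). -/
theorem bx_bit {n : ℕ} {f g : CubeFn (ZMod 3) n} (hf : IsInd f) (hg : IsInd g) (x : Fin n → Bool) :
    decide (bx f g x = 1) = xor (decide (f x = 1)) (decide (g x = 1)) := by
  simp only [bx, Pi.add_apply, Pi.mul_apply]
  have htab : ∀ a b : ZMod 3, (a = 0 ∨ a = 1) → (b = 0 ∨ b = 1) →
      decide (a + b + a * b = 1) = xor (decide (a = 1)) (decide (b = 1)) := by decide
  exact htab _ _ (hf x) (hg x)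

/-- ScaleDialCA helper `bx_mem_lowDeg` (decomp-qadv land package; see the module docstring). -/
theorem bx_mem_lowDeg {n a b : ℕ} {f g : CubeFn (ZMod 3) n} (hf : f ∈ lowDeg (ZMod 3) n a)
    (hg : g ∈ lowDeg (ZMod 3) n b) : bx f g ∈ lowDeg (ZMod 3) n (a + b) :=
  Submodule.add_mem _ (Submodule.add_mem _ (lowDeg_mono (by omega) hf) (lowDeg_mono (by omega) hg))
    (mul_mem_lowDeg_add hf hg)

/-- coordinate indicator `[u_j]`. -/
def cInd {n : ℕ} (j : Fin n) : CubeFn (ZMod 3) n := fun u => if u j = true then 1 else 0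

/-- ScaleDialCA helper `cInd_isInd` (decomp-qadv land package; see the module docstring). -/
theorem cInd_isInd {n : ℕ} (j : Fin n) : IsInd (cInd j) := by
  intro u; unfold cInd; split_ifs <;> simp

/-- ScaleDialCA helper `cInd_bit` (decomp-qadv land package; see the module docstring). -/
theorem cInd_bit {n : ℕ} (j : Fin n) (u : Fin n → Bool) : decide (cInd j u = 1) = u j := by
  unfold cInd; rcases Bool.eq_false_or_eq_true (u j) with h | h <;> simp [h]

/-- ScaleDialCA helper `cInd_mem_lowDeg` (decomp-qadv land package; see the module docstring). -/
theorem cInd_mem_lowDeg {n : ℕ} (j : Fin n) : cInd j ∈ lowDeg (ZMod 3) n 1 := by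
  unfold cInd; exact ind_coord_mem_lowDeg j 1 le_rfl

/-! ### C4. Strategies, profiles, and the two one-step pull-backs with PROFILE bookkeeping -/

/-- a strategy on `C_n`: one `𝔽₃` cube function per site (reply bit `[P_i(x) = 1]`). -/
abbrev Str (n : ℕ) := Fin n → CubeFn (ZMod 3) n

/-- the reply string. -/
def bits {n : ℕ} (P : Str n) (x : Fin n → Bool) : Fin n → Bool := fun i => decide (P i x = 1)

/-- `P` wins on `x`. -/
def Wins {n : ℕ} (P : Str n) (x : Fin n → Bool) : Prop := RingHLF.Rel x (bits P x)

/-- **the instrument cell `PerfectAt n d`** (lens-1 g3/g4/g10, verbatim): some degree-`≤ d` strategy is perfect on the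
odd class of `C_n`. -/
def PerfectAt (n d : ℕ) : Prop :=
  ∃ P : Str n, (∀ i, P i ∈ lowDeg (ZMod 3) n d) ∧ ∀ x : Fin n → Bool, OddZeros x → RingHLF.Rel x (fun i => decide (P i x = 1))

/-- ScaleDialCA helper `perfectAt_mono` (decomp-qadv land package; see the module docstring). -/
theorem perfectAt_mono {n d d' : ℕ} (h : d ≤ d') : PerfectAt n d → PerfectAt n d' := by
  rintro ⟨P, hP, hwin⟩
  exact ⟨P, fun i => lowDeg_mono h (hP i), hwin⟩

/-- `NoPerfectOdd3` in cells. [bookkeeping] -/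
theorem noPerfectOdd3_iff_cells : NoPerfectOdd3 ↔ ∀ c : ℕ, ∃ n₀ : ℕ, ∀ n ≥ n₀, ¬ PerfectAt n ((Nat.log 2 n) ^ c) := by
  unfold Summit.QuantumAdvantage.QuantumAdvantage.Theses.ExactnessDial.NoPerfectOdd3 PerfectAt
  refine forall_congr' fun c => exists_congr fun n₀ => forall_congr' fun n => forall_congr' fun hn => ?_
  constructor
  · rintro h ⟨P, hP, hwin⟩
    obtain ⟨x, hx, hnot⟩ := h P hP
    exact hnot (hwin x hx)
  · intro h P hP
    by_contra hcon
    push Not at hcon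
    exact h ⟨P, hP, fun x hx => hcon x hx⟩

/-- three-slot degree PROFILE of an indicator strategy on `C_{N+1}`: site `0` `≤ E`, last site `≤ L`, others `≤ D`. -/
def ProfLE (N : ℕ) (P : Str (N + 1)) (E D L : ℕ) : Prop :=
  (∀ i, IsInd (P i)) ∧ P 0 ∈ lowDeg (ZMod 3) (N + 1) E ∧ P (Fin.last N) ∈ lowDeg (ZMod 3) (N + 1) L ∧
    ∀ i : Fin (N + 1), i ≠ 0 → i ≠ Fin.last N → P i ∈ lowDeg (ZMod 3) (N + 1) D

/-- ScaleDialCA helper `profLE_mono` (decomp-qadv land package; see the module docstring). -/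
theorem profLE_mono {N : ℕ} {P : Str (N + 1)} {E D L E' L' : ℕ} (hE : E ≤ E') (hL : L ≤ L')
    (h : ProfLE N P E D L) : ProfLE N P E' D L' :=
  ⟨h.1, lowDeg_mono hE h.2.1, lowDeg_mono hL h.2.2.1, h.2.2.2⟩

/-- ScaleDialCA helper `profLE_all` (decomp-qadv land package; see the module docstring). -/
theorem profLE_all {N : ℕ} {P : Str (N + 1)} {E D L : ℕ} (h : ProfLE N P E D L) (hD : D ≤ E) (hL : L ≤ E) :
    ∀ i, P i ∈ lowDeg (ZMod 3) (N + 1) E := by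
  intro i
  by_cases h0 : i = 0
  · rw [h0]; exact h.2.1
  · by_cases hl : i = Fin.last N
    · rw [hl]; exact lowDeg_mono hL h.2.2.1
    · exact lowDeg_mono hD (h.2.2.2 i h0 hl)

/-- ScaleDialCA helper `bdry_eq_true_iff` (decomp-qadv land package; see the module docstring). -/
theorem bdry_eq_true_iff {m : ℕ} (i : Fin (m + 1)) : bdry m i = true ↔ (i.val = 0 ∨ i.val = m) := by
  unfold bdry; rw [decide_eq_true_iff]

/-- **stitch pull-back with profile** (`m ≥ 2`): a profile-`(E,D,L)` indicator strategy `P'` on `C_{m+2}` pulls back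
along `yLift` to an indicator strategy `S` on `C_{m+1}` of profile `(E+L+1, D, D+L+1)` with
`Wins P' (yLift x) ↔ Wins S x` for every `x`. -/
theorem stitch_pull {m : ℕ} (hm : 2 ≤ m) {E D L : ℕ} (P' : Str (m + 2)) (hP' : ProfLE (m + 1) P' E D L) :
    ∃ S : Str (m + 1), ProfLE m S (E + L + 1) D (D + L + 1) ∧ ∀ x, Wins P' (yLift x) ↔ Wins S x := by
  obtain ⟨hind, h0, hlast, hmid⟩ := hP'
  have hcomp : ∀ b e, P' b ∈ lowDeg (ZMod 3) (m + 2) e →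
      (fun u : Fin (m + 1) → Bool => P' b (yLift u)) ∈ lowDeg (ZMod 3) (m + 1) e :=
    fun b e hb => Smolensky.comp_mem_lowDeg_of_coord yLift yLift_coord_mem_lowDeg hb
  let A : Str (m + 1) := fun i u => P' (Fin.castSucc i) (yLift u)
  let Nw : CubeFn (ZMod 3) (m + 1) := fun u => P' (Fin.last (m + 1)) (yLift u)
  have hAind : ∀ i, IsInd (A i) := fun i u => hind _ _
  have hNind : IsInd Nw := fun u => hind _ _
  have hAdeg : ∀ i e, P' (Fin.castSucc i) ∈ lowDeg (ZMod 3) (m + 2) e → A i ∈ lowDeg (ZMod 3) (m + 1) e :=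
    fun i e h => hcomp _ e h
  have hNdeg : Nw ∈ lowDeg (ZMod 3) (m + 1) L := hcomp _ L hlast
  let S : Str (m + 1) := fun i => if bdry m i = true then bx (bx (A i) Nw) (cInd i) else A i
  refine ⟨S, ⟨?_, ?_, ?_, ?_⟩, fun x => ?_⟩
  · intro i; simp only [S]
    split_ifs
    · exact bx_isInd (bx_isInd (hAind i) hNind) (cInd_isInd i)
    · exact hAind i
  · have hS0 : S 0 = bx (bx (A 0) Nw) (cInd 0) := by simp only [S, bdry_zero, if_true]
    rw [hS0]
    have hc : (Fin.castSucc (0 : Fin (m + 1)) : Fin (m + 2)) = 0 := Fin.ext rfl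
    have hA0 : A 0 ∈ lowDeg (ZMod 3) (m + 1) E := hAdeg 0 E (by rw [hc]; exact h0)
    have := bx_mem_lowDeg (bx_mem_lowDeg hA0 hNdeg) (cInd_mem_lowDeg (0 : Fin (m + 1)))
    exact this
  · have hSl : S (Fin.last m) = bx (bx (A (Fin.last m)) Nw) (cInd (Fin.last m)) := by simp only [S, bdry_last, if_true]
    rw [hSl]
    have h1 : (Fin.castSucc (Fin.last m) : Fin (m + 2)) ≠ 0 := by
      intro h; have := congrArg Fin.val h; simp at this; omega
    have h2 : (Fin.castSucc (Fin.last m) : Fin (m + 2)) ≠ Fin.last (m + 1) := by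
      intro h; have := congrArg Fin.val h; simp at this
    have hAl : A (Fin.last m) ∈ lowDeg (ZMod 3) (m + 1) D := hAdeg _ D (hmid _ h1 h2)
    exact bx_mem_lowDeg (bx_mem_lowDeg hAl hNdeg) (cInd_mem_lowDeg (Fin.last m))
  · intro i hi0 hil
    have hi0' : i.val ≠ 0 := fun h => hi0 (Fin.ext h)
    have hil' : i.val ≠ m := fun h => hil (Fin.ext (by simp [h]))
    have hb : bdry m i = false := by
      rw [Bool.eq_false_iff, ne_eq, bdry_eq_true_iff]; push Not; exact ⟨hi0', hil'⟩
    have hSi : S i = A i := by simp only [S, hb]; simp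
    rw [hSi]
    have h1 : (Fin.castSucc i : Fin (m + 2)) ≠ 0 := by
      intro h; have := congrArg Fin.val h; simp at this; exact hi0 this
    have h2 : (Fin.castSucc i : Fin (m + 2)) ≠ Fin.last (m + 1) := by
      intro h; have := congrArg Fin.val h; simp at this; have := i.isLt; omega
    exact hAdeg _ D (hmid _ h1 h2)
  · have hbits : bits S x = yPull x (bits P' (yLift x)) := by
      funext i
      show decide (S i x = 1) = xor (decide (P' (Fin.castSucc i) (yLift x) = 1))
        (bdry m i && xor (decide (P' (Fin.last (m + 1)) (yLift x) = 1)) (x i))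
      by_cases hB : bdry m i = true
      · have hSi : S i = bx (bx (A i) Nw) (cInd i) := by simp only [S, hB, if_true]
        rw [hSi, bx_bit (bx_isInd (hAind i) hNind) (cInd_isInd i), bx_bit (hAind i) hNind, cInd_bit, hB, Bool.true_and]
        show xor (xor (decide (P' (Fin.castSucc i) (yLift x) = 1)) (decide (P' (Fin.last (m + 1)) (yLift x) = 1))) (x i) = _
        cases decide (P' (Fin.castSucc i) (yLift x) = 1) <;> cases decide (P' (Fin.last (m + 1)) (yLift x) = 1) <;>
          cases x i <;> rfl
      · have hSi : S i = A i := by simp only [S, hB]; simp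
        rw [hSi, Bool.eq_false_iff.2 hB, Bool.false_and, Bool.xor_false]
    show RingHLF.Rel (yLift x) (bits P' (yLift x)) ↔ RingHLF.Rel x (bits S x)
    rw [hbits]
    exact rel_yLift_iff hm x _

/-- **fold pull-back with profile** (`N ≥ 1`): a profile-`(E,D,L)` indicator strategy `P'` on `C_{N+3}` pulls back along
`pad` to an indicator strategy `R` on `C_{N+1}` of profile `(E+D, D, D+L)` with `Wins P' (pad x) → Wins R x`. -/
theorem fold_pull {N : ℕ} (hN : 1 ≤ N) {E D L : ℕ} (P' : Str (N + 3)) (hP' : ProfLE (N + 2) P' E D L) :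
    ∃ R : Str (N + 1), ProfLE N R (E + D) D (D + L) ∧ ∀ x, Wins P' (pad x) → Wins R x := by
  obtain ⟨hind, h0, hlast, hmid⟩ := hP'
  have hpad : ∀ b e, P' b ∈ lowDeg (ZMod 3) (N + 3) e →
      (fun u : Fin (N + 1) → Bool => P' b (pad u)) ∈ lowDeg (ZMod 3) (N + 1) e :=
    fun b e hb => Smolensky.comp_subst_mem_lowDeg pad pad_coord hb
  let A : Str (N + 1) := fun i u => P' (Fin.castAdd 2 i) (pad u)
  let B0 : CubeFn (ZMod 3) (N + 1) := fun u => P' (Fin.natAdd (N + 1) (0 : Fin 2)) (pad u)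
  let B1 : CubeFn (ZMod 3) (N + 1) := fun u => P' (Fin.natAdd (N + 1) (1 : Fin 2)) (pad u)
  have hAind : ∀ i, IsInd (A i) := fun i u => hind _ _
  have hB0ind : IsInd B0 := fun u => hind _ _
  have hB1ind : IsInd B1 := fun u => hind _ _
  -- positions in the big cycle `Fin (N+3)` (last = `N+2`)
  have hc0 : (Fin.castAdd 2 (0 : Fin (N + 1)) : Fin (N + 3)) = 0 := Fin.ext rfl
  have hA0 : A 0 ∈ lowDeg (ZMod 3) (N + 1) E := hpad _ E (by rw [hc0]; exact h0)
  have hmidA : ∀ i : Fin (N + 1), i ≠ 0 → A i ∈ lowDeg (ZMod 3) (N + 1) D := by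
    intro i hi0
    refine hpad _ D (hmid _ ?_ ?_)
    · intro h; apply hi0; rw [Fin.ext_iff] at h ⊢; simpa using h
    · intro h; rw [Fin.ext_iff] at h; simp at h; have := i.isLt; omega
  have hB0 : B0 ∈ lowDeg (ZMod 3) (N + 1) D := by
    refine hpad _ D (hmid _ ?_ ?_)
    · intro h; have := congrArg Fin.val h; simp at this
    · intro h; have := congrArg Fin.val h; simp at this
  have hB1 : B1 ∈ lowDeg (ZMod 3) (N + 1) L := by
    have : (Fin.natAdd (N + 1) (1 : Fin 2) : Fin (N + 3)) = Fin.last (N + 2) := Fin.ext (by simp)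
    exact hpad _ L (by rw [this]; exact hlast)
  let R : Str (N + 1) := fun i => if i.val = 0 then bx (A i) B0 else if i.val = N + 1 - 1 then bx (A i) B1 else A i
  have hN1 : N + 1 - 1 = N := rfl
  refine ⟨R, ⟨?_, ?_, ?_, ?_⟩, fun x hw => ?_⟩
  · intro i; simp only [R]
    split_ifs
    · exact bx_isInd (hAind i) hB0ind
    · exact bx_isInd (hAind i) hB1ind
    · exact hAind i
  · have hR0 : R 0 = bx (A 0) B0 := by simp only [R]; simp
    rw [hR0]; exact bx_mem_lowDeg hA0 hB0
  · have hne : (Fin.last N : Fin (N + 1)).val ≠ 0 := by simp; omega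
    have hRl : R (Fin.last N) = bx (A (Fin.last N)) B1 := by
      simp only [R, hN1, Fin.val_last, if_neg hne]
      simp
    rw [hRl]
    exact bx_mem_lowDeg (hmidA _ (fun h => hne (by rw [h]; rfl))) hB1
  · intro i hi0 hil
    have hi0' : i.val ≠ 0 := fun h => hi0 (Fin.ext h)
    have hil' : i.val ≠ N := fun h => hil (Fin.ext (by simp [h]))
    have hRi : R i = A i := by simp only [R, hN1, if_neg hi0', if_neg hil']
    rw [hRi]; exact hmidA i hi0
  · -- win transport DOWN the fold (kernel lift, sign bit unchanged, dot products regroup)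
    intro v hv
    have hN2 : 2 ≤ N + 1 := by omega
    have hrel := hw (lift (by omega) v) (inKernel_lift hN2 hv)
    rw [signBit_lift hN2] at hrel
    rw [dot2_fold hN2 v (bits P' (pad x)) (bits R x) fun i => ?_]
    · exact hrel
    · simp only [bits]
      by_cases h0 : i.val = 0
      · have hRi : R i = bx (A i) B0 := by simp only [R, if_pos h0]
        rw [hRi, bx_bit (hAind i) hB0ind, if_pos h0]
      · by_cases hl : i.val = N + 1 - 1
        · have hRi : R i = bx (A i) B1 := by simp only [R, if_neg h0, if_pos hl]
          rw [hRi, bx_bit (hAind i) hB1ind, if_neg h0, if_pos hl]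
        · have hRi : R i = A i := by simp only [R, if_neg h0, if_neg hl]
          rw [hRi, if_neg h0, if_neg hl, Bool.xor_false]

/-! ### C5. Degree ladders `lDeg`, `eDeg` (closed forms) -/

/-- last-site degree after `j` one-vertex operations. -/
def lDeg (D j : ℕ) : ℕ := D + j * (D + 1)
/-- site-`0` degree after `j` operations. -/
def eDeg (D j : ℕ) : ℕ := D + j * (j + 1) * (D + 1)

/-- ScaleDialCA helper `lDeg_step` (decomp-qadv land package; see the module docstring). -/
theorem lDeg_step (D j : ℕ) : D + lDeg D j + 1 = lDeg D (j + 1) := by unfold lDeg; ring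
/-- ScaleDialCA helper `eDeg_step` (decomp-qadv land package; see the module docstring). -/
theorem eDeg_step (D j : ℕ) : eDeg D j + lDeg D j + 1 ≤ eDeg D (j + 1) := by unfold eDeg lDeg; nlinarith

end Absorb
end Summit.QuantumAdvantage.QuantumAdvantage.Theorems.ScaleDial
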